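import Summits.KontsevichZagierPeriods.KontsevichZagierPeriods.Theorems.RootDecompWalshStrataConeChart

/-!
# The 4-ball specimen, part 1/4: the orthant cell, the source band, the Dirichlet-polar chart

Route `RootDecompWalshStrata` (cell decomp-kz, lens 4, gen 11), support toward `QuadricSignKernel`
(item stmt-KontsevichZagierPeriods-25393), slice `d = 4` of the quadric descent (node file
`RootDecompWalshStrataQuadricFourRung.lean`: `QuadricTwoDescentFour`).  The specimen is the orthant of the
unit 4-ball as a weighted Walsh cell `[(0,1)⁴ ∩ {1 − x₀² − x₁² − x₂² − x₃² > 0}, q]` (value `q·π²/32`,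
weight 2).  This part: the cell polynomial, the SOURCE representation
`[A₁, q·w₃]`, `A₁ = {w₀,w₁,w₂ ∈ (0,1), w₃ > 0, w₀² + w₁² + (w₃(1−w₂))² + (w₃w₂)² < 1}`, and the fibrewise
DIRICHLET-POLAR CHART `Ψ(w) = (w₀, w₁, w₃(1 − w₂), w₃ w₂)` (polynomial, Jacobian `−w₃`, injective on
`{w₃ > 0}`, onto the cell), giving the rule-(2) relation `[A₁, q·w₃] − [cell, q] ∈ KZ.relations`.  No square
root and no symmetry splitting is needed: the slope coordinate `w₂ = x₃/(x₂ + x₃)` ranges over `(0,1)`.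
Imports: the landed cone-specimen part 1 (Walsh cells `cellRep`, `cubeCell_subset_Icc`); 0 sorry.
[KontsevichZagier2001 §1.1–1.2]
-/

noncomputable section

open Literature.NumberTheory.Transcendental
open MeasureTheory Set
open MvPolynomial (aeval X C)
open Literature.ModelTheory.ExponentialFields (IsSemialgebraic isSemialgebraic_setOf_eval_pos
  isSemialgebraic_setOf_eval_lt continuous_aeval_real)
open Summit.KontsevichZagierPeriods.RootDecompWalshStrata.WalshSpanProof (isSemialgebraic_cubeSet
  isBounded_cubeSet cellRep cellRep_domain cellRep_integrand)
open Summit.KontsevichZagierPeriods.RootDecompWalshStrata.ConeSpecimen (cubeCell_subset_Icc)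

namespace Summit.KontsevichZagierPeriods.RootDecompWalshStrata.Ball4

/-! #### The orthant of the 4-ball and the pulled-back quadric -/

/-- `1 − x₀² − x₁² − x₂² − x₃²` (the orthant of the unit 4-ball inside `(0,1)⁴`). -/
def ball4Poly : MvPolynomial (Fin 4) ℚ := 1 - X 0 ^ 2 - X 1 ^ 2 - X 2 ^ 2 - X 3 ^ 2

/-- Evaluation of the ball polynomial. [definition] -/
@[simp] theorem aeval_ball4Poly (x : Fin 4 → ℝ) :
    aeval x ball4Poly = 1 - x 0 ^ 2 - x 1 ^ 2 - x 2 ^ 2 - x 3 ^ 2 := by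
  simp [ball4Poly]

/-- The ball polynomial pulled back along the chart: `1 − w₀² − w₁² − (w₃(1−w₂))² − (w₃w₂)²`. -/
def srcPoly : MvPolynomial (Fin 4) ℚ :=
  1 - X 0 ^ 2 - X 1 ^ 2 - (X 3 * (1 - X 2)) ^ 2 - (X 3 * X 2) ^ 2

/-- Evaluation of the pulled-back polynomial. [definition] -/
@[simp] theorem aeval_srcPoly (w : Fin 4 → ℝ) :
    aeval w srcPoly = 1 - w 0 ^ 2 - w 1 ^ 2 - (w 3 * (1 - w 2)) ^ 2 - (w 3 * w 2) ^ 2 := by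
  simp [srcPoly]

/-! #### The source domain `A₁` and the source representation `[A₁, q·w₃]` -/

/-- The source domain `A₁ = {w | (w₀,w₁,w₂) ∈ (0,1)³, 0 < w₃, srcPoly(w) > 0}`. -/
def srcSet : Set (Fin 4 → ℝ) :=
  {w | Fin.init w ∈ {u : Fin 3 → ℝ | ∀ j, 0 < u j ∧ u j < 1} ∧ 0 < w (Fin.last 3) ∧
    0 < aeval w srcPoly}

/-- Membership in the source domain, in coordinates. [definition] -/
theorem mem_srcSet {w : Fin 4 → ℝ} :
    w ∈ srcSet ↔ (0 < w 0 ∧ w 0 < 1) ∧ (0 < w 1 ∧ w 1 < 1) ∧ (0 < w 2 ∧ w 2 < 1) ∧ 0 < w 3 ∧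
      0 < 1 - w 0 ^ 2 - w 1 ^ 2 - (w 3 * (1 - w 2)) ^ 2 - (w 3 * w 2) ^ 2 := by
  simp only [srcSet, mem_setOf_eq, aeval_srcPoly, Fin.init]
  constructor
  · rintro ⟨hu, h3, hP⟩
    exact ⟨hu 0, hu 1, hu 2, h3, hP⟩
  · rintro ⟨h0, h1, h2, h3, hP⟩
    refine ⟨fun j => ?_, h3, hP⟩
    fin_cases j
    · exact h0
    · exact h1
    · exact h2

/-- The source domain is `ℚ`-semialgebraic. [BCR1998 §2.1] -/
theorem isSemialgebraic_srcSet : IsSemialgebraic ℚ srcSet := by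
  have h := (((isSemialgebraic_cubeSet 3).setOf_init_mem).inter
    (isSemialgebraic_setOf_eval_pos (X (Fin.last 3) : MvPolynomial (Fin 4) ℚ))).inter
    (isSemialgebraic_setOf_eval_pos srcPoly)
  convert h using 1
  ext w
  simp only [srcSet, mem_setOf_eq, mem_inter_iff, MvPolynomial.aeval_X, and_assoc]

/-- The source domain lies in the box `[0,2]⁴` (`w₃ = w₃(1−w₂) + w₃w₂ < 1 + 1`). [folklore] -/
theorem srcSet_subset_Icc : srcSet ⊆ Icc 0 2 := by
  intro w hw
  rw [mem_srcSet] at hw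
  obtain ⟨h0, h1, h2, h3, hP⟩ := hw
  have ha : w 3 * (1 - w 2) < 1 := by
    have hpos : 0 < w 3 * (1 - w 2) := mul_pos h3 (by linarith [h2.2])
    nlinarith [sq_nonneg (w 0), sq_nonneg (w 1), sq_nonneg (w 3 * w 2)]
  have hb : w 3 * w 2 < 1 := by
    have hpos : 0 < w 3 * w 2 := mul_pos h3 h2.1
    nlinarith [sq_nonneg (w 0), sq_nonneg (w 1), sq_nonneg (w 3 * (1 - w 2))]
  have h3' : w 3 < 2 := by nlinarith
  refine ⟨fun j => ?_, fun j => ?_⟩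
  · fin_cases j
    · exact h0.1.le
    · exact h1.1.le
    · exact h2.1.le
    · exact h3.le
  · fin_cases j
    · simpa using (h0.2.trans one_lt_two).le
    · simpa using (h1.2.trans one_lt_two).le
    · simpa using (h2.2.trans one_lt_two).le
    · simpa using h3'.le

/-- `[A₁, q·w₃]`: the source representation (polynomial weight on a bounded semialgebraic domain).
[KontsevichZagier2001 §1.1] -/
def srcRep (q : ℚ) : KZ.IntegralRep 4 where
  domain := srcSet
  integrand w := (q : ℝ) * w 3
  isSemialgebraic_domain := isSemialgebraic_srcSet
  isSemialgebraicFunOn_integrand :=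
    (isSemialgebraicFunOn_aeval isSemialgebraic_srcSet (C q * X 3)).congr fun w _ => by simp
  integrableOn :=
    ((continuous_const.mul (continuous_apply 3)).continuousOn.integrableOn_compact
      isCompact_Icc).mono_set srcSet_subset_Icc

/-- The domain of the source representation. [definition] -/
@[simp] theorem srcRep_domain (q : ℚ) : (srcRep q).domain = srcSet := rfl

/-- The integrand of the source representation. [definition] -/
@[simp] theorem srcRep_integrand (q : ℚ) (w : Fin 4 → ℝ) :
    (srcRep q).integrand w = (q : ℝ) * w 3 := rfl

/-! #### The fibrewise Dirichlet-polar chart `Ψ(w) = (w₀, w₁, w₃(1 − w₂), w₃w₂)` -/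

/-- The chart as a polynomial map. -/
def psiPoly : Fin 4 → MvPolynomial (Fin 4) ℚ := ![X 0, X 1, X 3 * (1 - X 2), X 3 * X 2]

/-- `Ψ(w) = (w₀, w₁, w₃(1 − w₂), w₃ w₂)`. -/
def psi : (Fin 4 → ℝ) → (Fin 4 → ℝ) := fun w j => aeval w (psiPoly j)

/-- `Ψ(w)₀ = w₀`. [definition] -/
@[simp] theorem psi_zero (w : Fin 4 → ℝ) : psi w 0 = w 0 := by simp [psi, psiPoly]

/-- `Ψ(w)₁ = w₁`. [definition] -/
@[simp] theorem psi_one (w : Fin 4 → ℝ) : psi w 1 = w 1 := by simp [psi, psiPoly]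

/-- `Ψ(w)₂ = w₃(1 − w₂)`. [definition] -/
@[simp] theorem psi_two (w : Fin 4 → ℝ) : psi w 2 = w 3 * (1 - w 2) := by simp [psi, psiPoly]

/-- `Ψ(w)₃ = w₃ w₂`. [definition] -/
@[simp] theorem psi_three (w : Fin 4 → ℝ) : psi w 3 = w 3 * w 2 := by simp [psi, psiPoly]

/-- The Jacobian matrix of `Ψ` at `w`. -/
def psiMat (w : Fin 4 → ℝ) : Matrix (Fin 4) (Fin 4) ℝ :=
  !![1, 0, 0, 0; 0, 1, 0, 0; 0, 0, -(w 3), 1 - w 2; 0, 0, w 3, w 2]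

/-- The derivative of `Ψ` at `w` as a continuous linear map. -/
def psi' (w : Fin 4 → ℝ) : (Fin 4 → ℝ) →L[ℝ] (Fin 4 → ℝ) :=
  LinearMap.toContinuousLinearMap (Matrix.toLin' (psiMat w))

/-- `Ψ'(w)` acts by the Jacobian matrix. [calculus] -/
theorem psi'_apply (w v : Fin 4 → ℝ) (a : Fin 4) : psi' w v a = ∑ b, psiMat w a b * v b := by
  change Matrix.toLin' (psiMat w) v a = _
  rw [Matrix.toLin'_apply]
  rfl

/-- `det Ψ'(w) = −w₃`. [calculus] -/
theorem psi'_det (w : Fin 4 → ℝ) : (psi' w).det = -(w 3) := by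
  change LinearMap.det (Matrix.toLin' (psiMat w)) = _
  rw [LinearMap.det_toLin', psiMat, Matrix.det_succ_row_zero]
  simp [Fin.sum_univ_succ, Matrix.det_fin_three]
  ring

/-- `Ψ` is differentiable with derivative `Ψ'`. [calculus] -/
theorem hasFDerivAt_psi (w : Fin 4 → ℝ) : HasFDerivAt psi (psi' w) w := by
  have h0 : HasFDerivAt (fun y : Fin 4 → ℝ => psi y 0)
      ((ContinuousLinearMap.proj 0).comp (psi' w)) w := by
    have hf : (fun y : Fin 4 → ℝ => psi y 0) = fun y => y 0 := funext psi_zero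
    rw [hf]
    refine (hasFDerivAt_apply 0 w).congr_fderiv (ContinuousLinearMap.ext fun v => ?_)
    simp [psi'_apply, psiMat, Fin.sum_univ_four]
  have h1 : HasFDerivAt (fun y : Fin 4 → ℝ => psi y 1)
      ((ContinuousLinearMap.proj 1).comp (psi' w)) w := by
    have hf : (fun y : Fin 4 → ℝ => psi y 1) = fun y => y 1 := funext psi_one
    rw [hf]
    refine (hasFDerivAt_apply 1 w).congr_fderiv (ContinuousLinearMap.ext fun v => ?_)
    simp [psi'_apply, psiMat, Fin.sum_univ_four]
  have h2 : HasFDerivAt (fun y : Fin 4 → ℝ => psi y 2)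
      ((ContinuousLinearMap.proj 2).comp (psi' w)) w := by
    have hf : (fun y : Fin 4 → ℝ => psi y 2) = fun y => y 3 * (1 - y 2) := funext psi_two
    rw [hf]
    refine ((hasFDerivAt_apply 3 w).mul ((hasFDerivAt_apply 2 w).const_sub 1)).congr_fderiv
      (ContinuousLinearMap.ext fun v => ?_)
    simp [psi'_apply, psiMat, Fin.sum_univ_four]
  have h3 : HasFDerivAt (fun y : Fin 4 → ℝ => psi y 3)
      ((ContinuousLinearMap.proj 3).comp (psi' w)) w := by
    have hf : (fun y : Fin 4 → ℝ => psi y 3) = fun y => y 3 * y 2 := funext psi_three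
    rw [hf]
    refine ((hasFDerivAt_apply 3 w).mul (hasFDerivAt_apply 2 w)).congr_fderiv
      (ContinuousLinearMap.ext fun v => ?_)
    simp [psi'_apply, psiMat, Fin.sum_univ_four]
  refine hasFDerivAt_pi'' fun a => ?_
  fin_cases a
  · exact h0
  · exact h1
  · exact h2
  · exact h3

/-- `Ψ` is injective where `w₃ > 0` (`w₃ = Ψ₂ + Ψ₃`, `w₂ = Ψ₃ / w₃`). [calculus] -/
theorem injOn_psi : InjOn psi {w | 0 < w 3} := by
  intro x hx y _ hxy
  have e0 : x 0 = y 0 := by simpa using congrFun hxy 0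
  have e1 : x 1 = y 1 := by simpa using congrFun hxy 1
  have e2 : x 3 * (1 - x 2) = y 3 * (1 - y 2) := by simpa using congrFun hxy 2
  have e3 : x 3 * x 2 = y 3 * y 2 := by simpa using congrFun hxy 3
  have h3 : x 3 = y 3 := by linear_combination e2 + e3
  have h2 : x 2 = y 2 := by
    have h : x 3 * x 2 = x 3 * y 2 := by rw [e3, h3]
    exact mul_left_cancel₀ (ne_of_gt hx) h
  funext a
  fin_cases a
  · exact e0
  · exact e1
  · exact h2
  · exact h3

/-- `Ψ` maps the source domain onto the orthant cell `(0,1)⁴ ∩ {x₀² + x₁² + x₂² + x₃² < 1}`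
(inverse: `w = (x₀, x₁, x₃/(x₂+x₃), x₂+x₃)`). [calculus] -/
theorem image_psi :
    psi '' srcSet = {x | (∀ j, 0 < x j ∧ x j < 1) ∧ 0 < aeval x ball4Poly} := by
  ext x
  simp only [mem_image, mem_setOf_eq, aeval_ball4Poly]
  constructor
  · rintro ⟨w, hw, rfl⟩
    rw [mem_srcSet] at hw
    obtain ⟨h0, h1, h2, h3, hP⟩ := hw
    have ha0 : 0 < w 3 * (1 - w 2) := mul_pos h3 (by linarith [h2.2])
    have hb0 : 0 < w 3 * w 2 := mul_pos h3 h2.1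
    have ha : w 3 * (1 - w 2) < 1 := by
      nlinarith [sq_nonneg (w 0), sq_nonneg (w 1), sq_nonneg (w 3 * w 2)]
    have hb : w 3 * w 2 < 1 := by
      nlinarith [sq_nonneg (w 0), sq_nonneg (w 1), sq_nonneg (w 3 * (1 - w 2))]
    refine ⟨fun j => ?_, by simpa using hP⟩
    fin_cases j
    · simpa using h0
    · simpa using h1
    · simpa using ⟨ha0, ha⟩
    · simpa using ⟨hb0, hb⟩
  · rintro ⟨hx, hP⟩
    have hx0 := hx 0
    have hx1 := hx 1
    have hx2 := hx 2
    have hx3 := hx 3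
    have hs : 0 < x 2 + x 3 := add_pos hx2.1 hx3.1
    have hne : x 2 + x 3 ≠ 0 := hs.ne'
    refine ⟨![x 0, x 1, x 3 / (x 2 + x 3), x 2 + x 3], ?_, ?_⟩
    · rw [mem_srcSet]
      simp only [Matrix.cons_val_zero, Matrix.cons_val_one, Matrix.cons_val]
      refine ⟨hx0, hx1, ⟨div_pos hx3.1 hs, (div_lt_one hs).2 (by linarith [hx2.1])⟩, hs, ?_⟩
      have e2 : (x 2 + x 3) * (1 - x 3 / (x 2 + x 3)) = x 2 := by field_simp; ring
      have e3 : (x 2 + x 3) * (x 3 / (x 2 + x 3)) = x 3 := by field_simp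
      rw [e2, e3]
      linarith
    · funext a
      fin_cases a
      · simp
      · simp
      · simp only [Fin.reduceFinMk, psi_two, Matrix.cons_val]
        field_simp
        ring
      · simp only [Fin.reduceFinMk, psi_three, Matrix.cons_val]
        field_simp

/-! #### Move (2): `[A₁, q·w₃] − [cell, q]` is a change of variables along `Ψ` -/

/-- **Move (2):** `[A₁, q·w₃] − [(0,1)⁴ ∩ {Σ xᵢ² < 1}, q] ∈ KZ.relations` (`|det Ψ'| = w₃`).
[KontsevichZagier2001 §1.2 rule (2)] -/
theorem of_srcRep_sub_of_cell_mem_relations (q : ℚ) :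
    KZ.of (srcRep q) - KZ.of (cellRep ball4Poly q) ∈ KZ.relations := by
  refine KZ.changeOfVariablesRel_subset_relations
    ⟨4, srcRep q, cellRep ball4Poly q, psi, psi', ?_,
      fun w _ => (hasFDerivAt_psi w).hasFDerivWithinAt,
      injOn_psi.mono fun w hw => (mem_srcSet.1 hw).2.2.2.1, ?_, fun w hw => ?_, rfl⟩
  · exact isSemialgebraicMapOn_aeval (srcRep q).isSemialgebraic_domain psiPoly
  · rw [cellRep_domain, srcRep_domain, image_psi]
  · have h3 : 0 < w 3 := (mem_srcSet.1 hw).2.2.2.1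
    rw [srcRep_integrand, cellRep_integrand, psi'_det, abs_neg, abs_of_pos h3]

end Summit.KontsevichZagierPeriods.RootDecompWalshStrata.Ball4

end
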